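import Summits.ValiantsHypothesis.ValiantsHypothesis.Theorems.SymPencilPerFourPeeledFactor
import Summits.ValiantsHypothesis.ValiantsHypothesis.Theorems.SymPencilPerFourPeeledTwoPencil

/-!
# Route `SymPencil` — inner rank of the `2 | 2` row split of `per_4`, PEELED case: the
# TWO-PENCIL FRAME LEMMA on the reduced family (design side)
# (`--supports` stmt-ValiantsHypothesis-5674 `SdcSuperquadratic`; (8,8) column of the size tables,
# memo `NOTE-p8g15-5674-R2-two-pencil.md` §2; rung currency only)

**Theorem** (`twelve_le_card_of_frame`).  Let a reduced family (`exists_reduced_family` data: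
joint identity `hJ`, scalar outer blocks `v₀, v₀'`) be PEELED (non-zero correction).  Let
`a₀, a₁, y₀, y₁ ∈ K⁴` be a TWO-PENCIL FRAME: `t((a_j,0),(y_i,0)) = 0` (i.e. `ψ(a_j,y_i) = 0`), the
pure permanent matrix `P₀₀ = [per(a₀; e_b; y₀; e_l)]` invertible (`W₀ P₀₀ = 1`), the pencil
`(P₀₀, P₁₀)`, `P₁₀ = [per(a₀; e_b; y₁; e_l)]`, with an eigenbasis of pairwise distinct eigenvalues,
and `Q = P₁₁ - P₁₀ W₀ P₀₁ ≠ 0` (`P₀₁, P₁₁` the matrices for `a₁`).  Then `12 ≤ |κ|`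
(`false_of_frame`: `|κ| ≤ 11` is contradictory).  Proof: the sixteen vectors
`ν(e_b,y_i) = t((0,e_b),(y_i,0))`, `μ(a_j,e_l) = t((a_j,0),(0,e_l))` and `v₀, v₀'` satisfy the
hypotheses of the engine `…PeeledTwoPencil.twelve_le_card_of_gram` (Gram table from the reduced
identity by bidegree and polarisation; cross terms are pure permanents because `ψ(a_j,y_i) = 0`;
alternating blocks by polarising the isotropy of `ν(K⁴, y)`, `ν(b, K⁴)`), and
`…PeeledTwoPencilKey.exists_minor` supplies the Schur minor.

What this leaves for the cells `(8,8,10)`, `(8,8,11)`: for every correction matrix `Ψ` a frame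
must be exhibited (memo §4: recipes verified on all tested classes, the swap class apart) — NOT in
this file.  Honest framing: conditional step; no cell closes here; the window
`27 ≤ sdc(per_4) ≤ 29`, the crux `SdcSuperquadratic` and `VP ≠ VNP` are untouched.
No definitions, no named facts. [folklore]
-/

noncomputable section

-- single-conjunct layout: Sub = Summit, duplicated namespace component intended
set_option linter.dupNamespace false

namespace Summit.ValiantsHypothesis.ValiantsHypothesis.Theorems.SymPencilPerFourPeeledTwoPencilDesign

open Matrix Finset Module
open Summit.ValiantsHypothesis.ValiantsHypothesis.Theorems.SymPencilPerFourInnerRankRows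
open Summit.ValiantsHypothesis.ValiantsHypothesis.Theorems.SymPencilPerFourInnerRankTenPairs
open Summit.ValiantsHypothesis.ValiantsHypothesis.Theorems.SymPencilPerFourInnerRankScalarBlock
open Summit.ValiantsHypothesis.ValiantsHypothesis.Theorems.SymPencilPerFourInnerRankReducedFamily
open Summit.ValiantsHypothesis.ValiantsHypothesis.Theorems.SymPencilPerFourPeeledFrame
open Summit.ValiantsHypothesis.ValiantsHypothesis.Theorems.SymPencilPerFourPeeledTwoPencilKey
open Summit.ValiantsHypothesis.ValiantsHypothesis.Theorems.SymPencilPerFourPeeledTwoPencil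

universe u v

variable {K : Type u} [Field K]

/-- Expansion of the weighted square of a sum of four vectors. [folklore] -/
theorem wdot_four {κ : Type v} [Fintype κ] (c p q r s : κ → K) :
    ∑ i, c i * (p + q + r + s) i * (p + q + r + s) i =
      ∑ i, c i * p i * p i + ∑ i, c i * q i * q i + ∑ i, c i * r i * r i + ∑ i, c i * s i * s i +
      2 * (∑ i, c i * p i * q i + ∑ i, c i * p i * r i + ∑ i, c i * p i * s i +
        ∑ i, c i * q i * r i + ∑ i, c i * q i * s i + ∑ i, c i * r i * s i) := by
  simp only [Finset.mul_sum, mul_add, ← Finset.sum_add_distrib]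
  exact Finset.sum_congr rfl fun i _ => by simp only [Pi.add_apply]; ring

/-- **The two-pencil frame lemma on the reduced peeled family.**  See the module docstring.
[folklore] -/
theorem twelve_le_card_of_frame [CharZero K] {κ : Type v} [Fintype κ] [DecidableEq κ]
    (c : κ → K)
    (t : κ → (((Fin 4 → K) × (Fin 4 → K)) →ₗ[K] ((Fin 4 → K) × (Fin 4 → K)) →ₗ[K] K))
    (hJ : ∀ a b y₂ y₃ : Fin 4 → K,
      ∑ r, c r * (t r (a, b) (y₂, y₃)) ^ 2 = (Matrix.of ![a, b, y₂, y₃]).permanent)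
    (v₀ v₀' : κ → K) (hv₀ : ∀ (a x : Fin 4 → K), ∃ s : K, (fun r => t r (a, 0) (x, 0)) = s • v₀)
    (hv₀' : ∀ (b x : Fin 4 → K), ∃ s : K, (fun r => t r (0, b) (0, x)) = s • v₀')
    (hpeel : ∃ a b y z : Fin 4 → K, ∑ r, c r * t r (a, 0) (y, 0) * t r (0, b) (0, z) ≠ 0)
    (a₀ a₁ y₀ y₁ : Fin 4 → K)
    (hψ₀₀ : ∀ r, t r (a₀, 0) (y₀, 0) = 0) (hψ₀₁ : ∀ r, t r (a₀, 0) (y₁, 0) = 0)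
    (hψ₁₀ : ∀ r, t r (a₁, 0) (y₀, 0) = 0) (hψ₁₁ : ∀ r, t r (a₁, 0) (y₁, 0) = 0)
    (P₀₀ P₁₀ P₀₁ P₁₁ : Matrix (Fin 4) (Fin 4) K)
    (hP₀₀ : ∀ b l, P₀₀ b l = (Matrix.of ![a₀, Pi.single b 1, y₀, Pi.single l 1]).permanent)
    (hP₁₀ : ∀ b l, P₁₀ b l = (Matrix.of ![a₀, Pi.single b 1, y₁, Pi.single l 1]).permanent)
    (hP₀₁ : ∀ b l, P₀₁ b l = (Matrix.of ![a₁, Pi.single b 1, y₀, Pi.single l 1]).permanent)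
    (hP₁₁ : ∀ b l, P₁₁ b l = (Matrix.of ![a₁, Pi.single b 1, y₁, Pi.single l 1]).permanent)
    (W₀ : Matrix (Fin 4) (Fin 4) K) (hW₀ : W₀ * P₀₀ = 1)
    (v : Fin 4 → Fin 4 → K) (s : Fin 4 → K) (hv : ∀ j, P₁₀ *ᵥ v j = s j • P₀₀ *ᵥ v j)
    (hs : ∀ i j, i ≠ j → s i ≠ s j) (W : Matrix (Fin 4) (Fin 4) K) (hW : W * Matrix.of v = 1)
    (hQ : P₁₁ - P₁₀ * W₀ * P₀₁ ≠ 0) : 12 ≤ Fintype.card κ := by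
  classical
  -- zero-vector bookkeeping
  have t00 : ∀ r (p : (Fin 4 → K) × (Fin 4 → K)), t r ((0 : Fin 4 → K), (0 : Fin 4 → K)) p = 0 :=
    fun r p => by rw [show ((0 : Fin 4 → K), (0 : Fin 4 → K)) = (0 : (Fin 4 → K) × (Fin 4 → K))
      from rfl, map_zero, LinearMap.zero_apply]
  have t00' : ∀ r (p : (Fin 4 → K) × (Fin 4 → K)), t r p ((0 : Fin 4 → K), (0 : Fin 4 → K)) = 0 :=
    fun r p => by rw [show ((0 : Fin 4 → K), (0 : Fin 4 → K)) = (0 : (Fin 4 → K) × (Fin 4 → K))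
      from rfl, map_zero]
  obtain ⟨a', b', yy, zz, hne⟩ := hpeel
  -- v₀ facts (peeled branch of the scalar-block dichotomy)
  have hv0facts : (∑ r, c r * v₀ r ^ 2 = 0) ∧
      (∀ (a y : Fin 4 → K), ∑ r, c r * v₀ r * t r (a, 0) (0, y) = 0) ∧
      (∀ (b x : Fin 4 → K), ∑ r, c r * v₀ r * t r (0, b) (x, 0) = 0) := by
    rcases scalar_block_dichotomy c t hJ v₀ hv₀ with hz | h
    · exact absurd (Finset.sum_eq_zero fun r _ => by rw [hz a' yy r]; ring) hne
    · exact h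
  obtain ⟨hQv, hA₃, hB₂⟩ := hv0facts
  -- v₀' facts via the swapped design
  set tS : κ → (((Fin 4 → K) × (Fin 4 → K)) →ₗ[K] ((Fin 4 → K) × (Fin 4 → K)) →ₗ[K] K) :=
    fun r => ((t r).compl₁₂ (LinearEquiv.prodComm K (Fin 4 → K) (Fin 4 → K)).toLinearMap
      LinearMap.id).compl₂ (LinearEquiv.prodComm K (Fin 4 → K) (Fin 4 → K)).toLinearMap with htS
  have hJS : ∀ a b y₂ y₃ : Fin 4 → K,
      ∑ r, c r * (tS r (a, b) (y₂, y₃)) ^ 2 = (Matrix.of ![a, b, y₂, y₃]).permanent :=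
    hJ_yswap c _ (hJ_swap c t hJ)
  have htSap : ∀ r (a b y₂ y₃ : Fin 4 → K), tS r (a, b) (y₂, y₃) = t r (b, a) (y₃, y₂) :=
    fun r a b y₂ y₃ => by simp [htS]
  have hv0'facts : (∑ r, c r * v₀' r ^ 2 = 0) ∧
      (∀ (b y : Fin 4 → K), ∑ r, c r * v₀' r * t r (0, b) (y, 0) = 0) ∧
      (∀ (a x : Fin 4 → K), ∑ r, c r * v₀' r * t r (a, 0) (0, x) = 0) := by
    rcases scalar_block_dichotomy c tS hJS v₀' (fun b x => by
        obtain ⟨s, hs⟩ := hv₀' b x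
        exact ⟨s, by rw [← hs]; funext r; exact htSap r b 0 x 0⟩) with hz | ⟨h1, h2, h3⟩
    · refine absurd (Finset.sum_eq_zero fun r _ => ?_) hne
      have := hz b' zz r; rw [htSap] at this; rw [this]; ring
    · refine ⟨h1, fun b y => ?_, fun a x => ?_⟩
      · have := h2 b y; simpa only [htSap] using this
      · have := h3 a x; simpa only [htSap] using this
  obtain ⟨hQv', hB₂', hA₃'⟩ := hv0'facts
  -- ⟨v₀, v₀'⟩ ≠ 0
  have hlam : ∑ r, c r * v₀ r * v₀' r ≠ 0 := by
    obtain ⟨s, hs⟩ := hv₀ a' yy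
    obtain ⟨s', hs'⟩ := hv₀' b' zz
    have e1 : ∀ r, t r (a', 0) (yy, 0) = s * v₀ r := fun r => by
      have := congr_fun hs r; simpa using this
    have e2 : ∀ r, t r (0, b') (0, zz) = s' * v₀' r := fun r => by
      have := congr_fun hs' r; simpa using this
    intro h0
    apply hne
    have : ∑ r, c r * t r (a', 0) (yy, 0) * t r (0, b') (0, zz) =
        s * s' * ∑ r, c r * v₀ r * v₀' r := by
      rw [Finset.mul_sum]; exact Finset.sum_congr rfl fun r _ => by rw [e1, e2]; ring
    rw [this, h0, mul_zero]
  -- the bilinear map ν(b,y) = t((0,b),(y,0)) and μ(a,z) = t((a,0),(0,z))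
  let ν : (Fin 4 → K) →ₗ[K] (Fin 4 → K) →ₗ[K] (κ → K) :=
    LinearMap.mk₂ K (fun b y => fun r => t r (0, b) (y, 0))
      (fun b b' y => by
        funext r
        have : (((0 : Fin 4 → K), b + b') : (Fin 4 → K) × (Fin 4 → K)) = (0, b) + (0, b') := by simp
        simp only [Pi.add_apply, this, map_add, LinearMap.add_apply])
      (fun s b y => by
        funext r
        have : (((0 : Fin 4 → K), s • b) : (Fin 4 → K) × (Fin 4 → K)) = s • (0, b) := by simp
        simp only [Pi.smul_apply, this, map_smul, LinearMap.smul_apply, smul_eq_mul])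
      (fun b y y' => by
        funext r
        have : ((y + y', (0 : Fin 4 → K)) : (Fin 4 → K) × (Fin 4 → K)) = (y, 0) + (y', 0) := by simp
        simp only [Pi.add_apply, this, map_add])
      (fun s b y => by
        funext r
        have : ((s • y, (0 : Fin 4 → K)) : (Fin 4 → K) × (Fin 4 → K)) = s • (y, 0) := by simp
        simp only [Pi.smul_apply, this, map_smul, smul_eq_mul])
  have hνap : ∀ b y r, ν b y r = t r (0, b) (y, 0) := fun b y r => rfl
  let μ : (Fin 4 → K) →ₗ[K] (Fin 4 → K) →ₗ[K] (κ → K) :=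
    LinearMap.mk₂ K (fun a z => fun r => t r (a, 0) (0, z))
      (fun a a' z => by
        funext r
        have : ((a + a', (0 : Fin 4 → K)) : (Fin 4 → K) × (Fin 4 → K)) = (a, 0) + (a', 0) := by simp
        simp only [Pi.add_apply, this, map_add, LinearMap.add_apply])
      (fun s a z => by
        funext r
        have : ((s • a, (0 : Fin 4 → K)) : (Fin 4 → K) × (Fin 4 → K)) = s • (a, 0) := by simp
        simp only [Pi.smul_apply, this, map_smul, LinearMap.smul_apply, smul_eq_mul])
      (fun a z z' => by
        funext r
        have : (((0 : Fin 4 → K), z + z') : (Fin 4 → K) × (Fin 4 → K)) = (0, z) + (0, z') := by simp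
        simp only [Pi.add_apply, this, map_add])
      (fun s a z => by
        funext r
        have : (((0 : Fin 4 → K), s • z) : (Fin 4 → K) × (Fin 4 → K)) = s • (0, z) := by simp
        simp only [Pi.smul_apply, this, map_smul, smul_eq_mul])
  have hμap : ∀ a z r, μ a z r = t r (a, 0) (0, z) := fun a z r => rfl
  -- the reduced identity and its bidegree pieces
  have hred := reduced_identity_of_scalar c t hJ v₀ v₀' hv₀ hv₀'
  have hνiso : ∀ b y, ∑ r, c r * ν b y r * ν b y r = 0 := by
    intro b y
    have h := hred 0 b y 0
    simp only [t00, t00', add_zero, mul_zero, Finset.sum_const_zero, sub_zero,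
      per_zero_row₀] at h
    rw [← h]
    exact Finset.sum_congr rfl fun r _ => by rw [hνap]; ring
  have hμiso : ∀ a z, ∑ r, c r * μ a z r * μ a z r = 0 := by
    intro a z
    have h := hred a 0 0 z
    simp only [t00, t00', zero_add, mul_zero, Finset.sum_const_zero, sub_zero,
      per_zero_row₂] at h
    rw [← h]
    exact Finset.sum_congr rfl fun r _ => by rw [hμap]; ring
  have hX : ∀ a b y z, 2 * ∑ r, c r * ν b y r * μ a z r =
      (Matrix.of ![a, b, y, z]).permanent - 2 * ∑ r, c r * t r (a, 0) (y, 0) * t r (0, b) (0, z) := by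
    intro a b y z
    have h := hred a b y z
    have e : ∑ r, c r * (t r (0, b) (y, 0) + t r (a, 0) (0, z)) ^ 2 =
        ∑ r, c r * ν b y r * ν b y r + ∑ r, c r * μ a z r * μ a z r +
          2 * ∑ r, c r * ν b y r * μ a z r := by
      rw [Finset.mul_sum, ← Finset.sum_add_distrib, ← Finset.sum_add_distrib]
      exact Finset.sum_congr rfl fun r _ => by rw [hνap, hμap]; ring
    rw [e, hνiso, hμiso, zero_add, zero_add] at h
    exact h
  -- polarised isotropy: two ν's (resp. μ's) sharing an argument are orthogonal
  have hνν_b : ∀ b b' y, ∑ r, c r * ν b y r * ν b' y r = 0 := fun b b' y =>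
    wdot_eq_zero_of_isotropic c _ _ (hνiso b y) (hνiso b' y)
      (by rw [← LinearMap.add_apply, ← map_add]; exact hνiso (b + b') y)
  have hνν_y : ∀ b y y', ∑ r, c r * ν b y r * ν b y' r = 0 := fun b y y' =>
    wdot_eq_zero_of_isotropic c _ _ (hνiso b y) (hνiso b y') (by rw [← map_add]; exact hνiso b (y + y'))
  have hμμ_a : ∀ a a' z, ∑ r, c r * μ a z r * μ a' z r = 0 := fun a a' z =>
    wdot_eq_zero_of_isotropic c _ _ (hμiso a z) (hμiso a' z)
      (by rw [← LinearMap.add_apply, ← map_add]; exact hμiso (a + a') z)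
  have hμμ_z : ∀ a z z', ∑ r, c r * μ a z r * μ a z' r = 0 := fun a z z' =>
    wdot_eq_zero_of_isotropic c _ _ (hμiso a z) (hμiso a z') (by rw [← map_add]; exact hμiso a (z + z'))
  -- the alternating relations
  have hν4 : ∀ b b' y y', ∑ r, c r * ν b y r * ν b' y' r + ∑ r, c r * ν b y' r * ν b' y r = 0 := by
    intro b b' y y'
    have h := hνiso (b + b') (y + y')
    have hX : ν (b + b') (y + y') = ν b y + ν b y' + ν b' y + ν b' y' := by
      simp only [map_add, LinearMap.add_apply]; abel
    rw [hX, wdot_four, hνiso, hνiso, hνiso, hνiso, hνν_y b y y', hνν_b b b' y, hνν_b b b' y',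
      hνν_y b' y y'] at h
    have h' : (2 : K) * (∑ r, c r * ν b y r * ν b' y' r + ∑ r, c r * ν b y' r * ν b' y r) = 0 := by
      linear_combination h
    exact (mul_eq_zero.1 h').resolve_left two_ne_zero
  have hμ4 : ∀ a a' z z', ∑ r, c r * μ a z r * μ a' z' r + ∑ r, c r * μ a z' r * μ a' z r = 0 := by
    intro a a' z z'
    have h := hμiso (a + a') (z + z')
    have hX : μ (a + a') (z + z') = μ a z + μ a z' + μ a' z + μ a' z' := by
      simp only [map_add, LinearMap.add_apply]; abel
    rw [hX, wdot_four, hμiso, hμiso, hμiso, hμiso, hμμ_z a z z', hμμ_a a a' z, hμμ_a a a' z',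
      hμμ_z a' z z'] at h
    have h' : (2 : K) * (∑ r, c r * μ a z r * μ a' z' r + ∑ r, c r * μ a z' r * μ a' z r) = 0 := by
      linear_combination h
    exact (mul_eq_zero.1 h').resolve_left two_ne_zero
  -- the sixteen frame vectors and the alternating blocks
  set n₀ : Fin 4 → κ → K := fun b => ν (Pi.single b 1) y₀ with hn₀
  set n₁ : Fin 4 → κ → K := fun b => ν (Pi.single b 1) y₁ with hn₁
  set m₀ : Fin 4 → κ → K := fun l => μ a₀ (Pi.single l 1) with hm₀
  set m₁ : Fin 4 → κ → K := fun l => μ a₁ (Pi.single l 1) with hm₁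
  set A : Matrix (Fin 4) (Fin 4) K := Matrix.of fun b b' => 2 * ∑ r, c r * n₀ b r * n₁ b' r with hAd
  set A' : Matrix (Fin 4) (Fin 4) K := Matrix.of fun l l' => 2 * ∑ r, c r * m₀ l r * m₁ l' r
    with hA'd
  have hA : Aᵀ = -A := by
    ext b b'
    rw [transpose_apply, Matrix.neg_apply, hAd, Matrix.of_apply, Matrix.of_apply]
    have h := hν4 (Pi.single b 1) (Pi.single b' 1) y₀ y₁
    rw [wdot_comm c (ν (Pi.single b 1) y₁)] at h
    linear_combination (2 : K) * h
  have hA' : A'ᵀ = -A' := by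
    ext l l'
    rw [transpose_apply, Matrix.neg_apply, hA'd, Matrix.of_apply, Matrix.of_apply]
    have h := hμ4 a₀ a₁ (Pi.single l 1) (Pi.single l' 1)
    linear_combination (2 : K) * h
  -- symmetry of the pure permanent matrices
  have per_sym : ∀ (uu vv ww xx : Fin 4 → K),
      (Matrix.of ![uu, vv, ww, xx]).permanent = (Matrix.of ![uu, xx, ww, vv]).permanent :=
    fun uu vv ww xx => by simp only [permanent_of_rows]; ring
  have hP₀₀t : P₀₀ᵀ = P₀₀ := by ext b l; rw [transpose_apply, hP₀₀, hP₀₀]; exact per_sym _ _ _ _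
  have hP₁₀t : P₁₀ᵀ = P₁₀ := by ext b l; rw [transpose_apply, hP₁₀, hP₁₀]; exact per_sym _ _ _ _
  have hP₀₁t : P₀₁ᵀ = P₀₁ := by ext b l; rw [transpose_apply, hP₀₁, hP₀₁]; exact per_sym _ _ _ _
  have hP₁₁t : P₁₁ᵀ = P₁₁ := by ext b l; rw [transpose_apply, hP₁₁, hP₁₁]; exact per_sym _ _ _ _
  -- cross terms: pure permanents because ψ(a_j, y_i) = 0
  have cross : ∀ (a y : Fin 4 → K), (∀ r, t r (a, 0) (y, 0) = 0) → ∀ b l : Fin 4,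
      2 * ∑ r, c r * ν (Pi.single b 1) y r * μ a (Pi.single l 1) r =
        (Matrix.of ![a, Pi.single b 1, y, Pi.single l 1]).permanent := by
    intro a y hψ b l
    rw [hX, show ∑ r, c r * t r (a, 0) (y, 0) * t r (0, Pi.single b 1) (0, Pi.single l 1) = 0 from
      Finset.sum_eq_zero fun r _ => by rw [hψ r]; ring]
    ring
  -- the Schur minor
  obtain hminor := exists_minor A A' P₀₀ P₁₀ P₀₁ P₁₁ W₀ hA hP₀₀t hP₁₀t hP₀₁t hP₁₁t hW₀ v s hv hs W hW hQ
  -- apply the engine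
  refine twelve_le_card_of_gram c n₀ m₀ n₁ m₁ v₀ v₀' A A' P₀₀ P₁₀ P₀₁ P₁₁ W₀ hA hA'
    hP₀₀t hP₁₀t hP₀₁t hP₁₁t hW₀
    (fun b b' => hνν_b _ _ _) (fun b b' => hνν_b _ _ _) (fun b b' => rfl)
    (fun l l' => hμμ_z _ _ _) (fun l l' => hμμ_z _ _ _) (fun l l' => rfl)
    (fun b l => by rw [hP₀₀]; exact cross a₀ y₀ hψ₀₀ b l)
    (fun b l => by rw [hP₁₀]; exact cross a₀ y₁ hψ₀₁ b l)
    (fun b l => by rw [hP₀₁]; exact cross a₁ y₀ hψ₁₀ b l)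
    (fun b l => by rw [hP₁₁]; exact cross a₁ y₁ hψ₁₁ b l)
    (fun b => ⟨hB₂ _ _, hA₃ _ _, hB₂ _ _, hA₃ _ _⟩)
    (fun b => ⟨hB₂' _ _, hA₃' _ _, hB₂' _ _, hA₃' _ _⟩)
    (by rw [← hQv]; exact Finset.sum_congr rfl fun r _ => by ring)
    (by rw [← hQv']; exact Finset.sum_congr rfl fun r _ => by ring)
    hlam hminor

/-- **Contradiction form**: a reduced peeled family on `|κ| ≤ 11` squares admitting a two-pencil
frame is impossible. [folklore] -/
theorem false_of_frame [CharZero K] {κ : Type v} [Fintype κ] [DecidableEq κ]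
    (hκ : Fintype.card κ ≤ 11) (c : κ → K)
    (t : κ → (((Fin 4 → K) × (Fin 4 → K)) →ₗ[K] ((Fin 4 → K) × (Fin 4 → K)) →ₗ[K] K))
    (hJ : ∀ a b y₂ y₃ : Fin 4 → K,
      ∑ r, c r * (t r (a, b) (y₂, y₃)) ^ 2 = (Matrix.of ![a, b, y₂, y₃]).permanent)
    (v₀ v₀' : κ → K) (hv₀ : ∀ (a x : Fin 4 → K), ∃ s : K, (fun r => t r (a, 0) (x, 0)) = s • v₀)
    (hv₀' : ∀ (b x : Fin 4 → K), ∃ s : K, (fun r => t r (0, b) (0, x)) = s • v₀')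
    (hpeel : ∃ a b y z : Fin 4 → K, ∑ r, c r * t r (a, 0) (y, 0) * t r (0, b) (0, z) ≠ 0)
    (a₀ a₁ y₀ y₁ : Fin 4 → K)
    (hψ₀₀ : ∀ r, t r (a₀, 0) (y₀, 0) = 0) (hψ₀₁ : ∀ r, t r (a₀, 0) (y₁, 0) = 0)
    (hψ₁₀ : ∀ r, t r (a₁, 0) (y₀, 0) = 0) (hψ₁₁ : ∀ r, t r (a₁, 0) (y₁, 0) = 0)
    (P₀₀ P₁₀ P₀₁ P₁₁ : Matrix (Fin 4) (Fin 4) K)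
    (hP₀₀ : ∀ b l, P₀₀ b l = (Matrix.of ![a₀, Pi.single b 1, y₀, Pi.single l 1]).permanent)
    (hP₁₀ : ∀ b l, P₁₀ b l = (Matrix.of ![a₀, Pi.single b 1, y₁, Pi.single l 1]).permanent)
    (hP₀₁ : ∀ b l, P₀₁ b l = (Matrix.of ![a₁, Pi.single b 1, y₀, Pi.single l 1]).permanent)
    (hP₁₁ : ∀ b l, P₁₁ b l = (Matrix.of ![a₁, Pi.single b 1, y₁, Pi.single l 1]).permanent)
    (W₀ : Matrix (Fin 4) (Fin 4) K) (hW₀ : W₀ * P₀₀ = 1)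
    (v : Fin 4 → Fin 4 → K) (s : Fin 4 → K) (hv : ∀ j, P₁₀ *ᵥ v j = s j • P₀₀ *ᵥ v j)
    (hs : ∀ i j, i ≠ j → s i ≠ s j) (W : Matrix (Fin 4) (Fin 4) K) (hW : W * Matrix.of v = 1)
    (hQ : P₁₁ - P₁₀ * W₀ * P₀₁ ≠ 0) : False := by
  have h := twelve_le_card_of_frame c t hJ v₀ v₀' hv₀ hv₀' hpeel a₀ a₁ y₀ y₁ hψ₀₀ hψ₀₁ hψ₁₀ hψ₁₁
    P₀₀ P₁₀ P₀₁ P₁₁ hP₀₀ hP₁₀ hP₀₁ hP₁₁ W₀ hW₀ v s hv hs W hW hQ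
  omega

end Summit.ValiantsHypothesis.ValiantsHypothesis.Theorems.SymPencilPerFourPeeledTwoPencilDesign

end
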